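import Summits.QuantumFields.YangMills.Theorems.FluctuationComparisonRegPrIntLS2BetaRelativeFieldLetter
import Summits.QuantumFields.YangMills.Theorems.FluctuationComparisonRegPrIntLS2BetaRelativeMemberLetters
import HarnessLib

/-!
# S2β · letter (D♮) REL-TEL, feeder F2-rel (UV3-NODE §84.4 (H♭)(i) «TWO-TOWER relative field letter along the SAME combs»), FILE C1:
# THE TWO-TOWER BOND LETTERS, POINTWISE — the relative flap `δ(W_b·U_b⁻¹, W⁰_b·U⁰_b⁻¹)` of two comb-axial pairs at an interior ∕ face bond is bounded by the
# RELATIVE contour loops of `(W, W⁰)` and of `(U, U⁰)`, the RELATIVE spine quotient, and (loop SIZES) × (relative comb transport)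

Cell `ym3-torus` (YM ladder rung R3 = continuum `SU(2)` Yang–Mills on the three-torus — a RUNG: NOT d = 4, NOT infinite volume, NOT a mass gap, NOT Clay).
Width seat «width 21» `ym3-torus-px21` (gen 23), FREE px helper on crux `stmt-QuantumFields-20520` (`Theses.UnitScaleTilt.FluctuationComparisonRegPrIntL`);
registry v11.4 `Cruxes/FluctuationComparisonRegPrIntL/Lines/semiclassical_s2beta.lean` 3732b7df FROZEN, untouched.  `--kind proof --supports stmt-QuantumFields-20520
--as helper`, count-neutral, DEFINITION-FREE (0 `def`, 0 `instance`, 0 `notation`, 0 `sorry`, default heartbeats), any gauge group + px10's commutator letter.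

WHY.  px12 g24's REL-TEL dock ✓p822621 ∕ ✓`…S2BetaStageAxialLetters` reduces the distance letter (D♮)∕(D-stage) of the registered stiffness organ GAP♯∘ to ONE
two-tower letter (L♭) ∧ (H♭) along the two STAGE towers `U′_j = g_j•M^jU`, `U′⁰_j = g⁰_j•M^jU₀` over the hat lifts `V_j = lift U′_{j+1}`, `V⁰_j = lift U′⁰_{j+1}`;
(L♭) is px12's; (H♭) bounds the RELATIVE FLAP `‖dist1 (P_j·P⁰_j⁻¹)‖_{ℓ²}`, `P_j = U′_j·V_j⁻¹`.  Its one-tower edition is px13 g22's F2 ✓`…S2BetaRelativeFieldLetter` (pointwise)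
∕ ✓`…RelativeFieldSquareSum(Plaq)` (`ℓ²`): in the comb axial gauge relative to the lift, `W_b·U_b⁻¹ = H⁻¹·Z·H` with `H` the background's comb transport and
`Z` a product of CLOSED LOOPS (interior: the contour loops of `W` and `U`; face: the face loops and the SPINE QUOTIENT), ✓`mul_inv_eq_conj_of_axial` ∕
✓`holAt_faceWord_of_axial`.  For TWO such pairs `(W, U)`, `(W⁰, U⁰)` the conjugators `H`, `H⁰` DIFFER, and px10 g23's δ-calculus (✓p822074
`dist1_rel_conj_le`: `δ(T·p·T⁻¹, T₀·p₀·T₀⁻¹) ≤ δ(p, p₀) + 2·dist1 p·δ(T, T₀)`) prices the difference by (loop SIZES) × (relative comb transport) — this file, pointwise,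
with every analytic input an explicit HYPOTHESIS letter (`a, b, s, σ, θ₁, θ₂, t`), so that FILE C2 can instantiate them by kernel: the relative loops by ✓p823652
`…RelativeWordStokes.dist1_holAt_rel_le_local`, the relative spine quotient by ✓`…S2BetaCorrLetterL2Relative` (F4-rel), the comb transport by ✓p823337 §1, the sizes by lit
✓`LatticeWordStokesLocal`, and sum in `ℓ²`.

CONTENT ([folklore] group bookkeeping; `δ(X, X₀) := dist1 (X₀⁻¹·X)`).
* §1 `dist1_invConj_rel_le` (`δ(H⁻¹ZH, H₀⁻¹Z₀H₀) ≤ δ(Z, Z₀) + 2·dist1 Z·dist1 (H⁻¹·H₀)`), `dist1_mulInv_rel_le`, `dist1_prod3_le` (px10's ✓p823031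
  `dist1_rel_prod3_le` for the relative triple product).
* §2 ★★`dist1_flap_rel_le_interior` — INTERIOR bonds `b = ⟨x, μ⟩` (both endpoints in the block of `y`), both pairs comb-axial from every block centre:
  `δ(W_b·U_b⁻¹, W⁰_b·U⁰_b⁻¹) ≤ a + b + 2·(θ₁ + θ₂)·t` where `a ≥ δ` of the contour loops `𝒰_{emb y}(contourT)` of `(W, W⁰)`, `b ≥` the same for `(U, U⁰)`,
  `θ₁, θ₂ ≥` the contour-loop SIZES of `W`, `U`, `t ≥` the relative comb transport `dist1 ((axialT U (emb y) x)⁻¹·axialT U⁰ (emb y) x)`.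
* §3 `holAt_faceLoop_eq` (the CLOSED face word `Γ_{y,x} ∪ [x,x+e_μ] ∪ (−Γ_{y+e_μ,x+e_μ}) ∪ (−spine)` has holonomy `H·W_b·H′⁻¹·T_c(W)⁻¹`), `flap_eq_invConj_face`
  (`W_b·U_b⁻¹ = H⁻¹·(C_W·(T_c(W)·T_c(U)⁻¹)·C_U⁻¹)·H`), ★★`dist1_flap_rel_le_face` — FACE bonds: `δ ≤ a + s + b + 2·(θ₁ + σ + θ₂)·t` with `s ≥ δ` of the SPINE QUOTIENTS
  `T_c(W)·T_c(U)⁻¹` vs `T_c(W⁰)·T_c(U⁰)⁻¹` (= F4-rel's letter once the backgrounds reproduce the (0.4) averages, ✓`dist1_axialAvg_mul_inv_eq_corr`) and `σ ≥` its size.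
COMB bonds: both flaps are `1` EXACTLY (✓`…StageGaugeTower.bond_eq_of_axial`), nothing to prove.

HONEST SCOPE.  Group algebra over landed identities; no analysis; nothing of Bałaban's is asserted; F2-rel in `ℓ²` (FILE C2), (H♭), (D-ax)∕(D♮), (F♮), `hIrr`∕`hA`, GAP♯∘
(`stub_uniformFibreGapOrbit`), S2β, the five registered stubs (0∕5), crux 20520, 19936, 19200 and `YM3TorusSU2` are NOT proved; no registered stub is closed by this
helper; rung R3 = SU(2) YM₃ on T³ at fixed lattice data — NOT d = 4, NOT infinite volume, NOT a mass gap, NOT Clay; the Yang–Mills mass gap is NOT proved.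
References: T. Bałaban, CMP **99** (1985) 75–102 [Balaban1985RegularSpaces] ((1.19) p.79, Lemma 1 (1.21)–(1.26) pp.79–80: the printed one-pair letter, relative in
gauge, absolute in size); CMP **98** (1985) 17–51 [Balaban1985Averaging] ((9)–(10) p.19, (19)–(20) p.21, pp.24–25); CMP **109** (1987) 249–301 [Balaban1987RG1]
((0.3)–(0.4) pp.252–253).
-/

set_option autoImplicit false

namespace Summit.QuantumFields.YangMills.Theorems.FluctuationComparisonRegPrIntLS2BetaRelativeFieldLetterTwoTower

open Literature.MathematicalPhysics.QuantumFieldTheory.Balaban1983to89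
open T4Continuum T4ReflectionCone BlockAveraging
open B10Eq47AxialChi (shiftN rowProd)
open B10Eq27TorusAxialLog (rel holT axialT contourT holT_eq_holAt)
open B7Prop1Explicit (treeWord)
open BlockAveragingEMLProp2 (emb_shift_eq_shiftN)
open Summit.QuantumFields.YangMills.Theorems.Prop7AxialGaugeSup (mul_inv_eq_conj_of_axial)
open Summit.QuantumFields.YangMills.Theorems.Prop7AxialGaugeFace (holAt_faceWord_of_axial walkEnd_treeWord_rel)
open Summit.QuantumFields.YangMills.Theorems.FluctuationComparisonRegPrIntLS2BetaIterAxialGaugeOneLevel (noWrap_emb)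
open Summit.QuantumFields.YangMills.Theorems.FluctuationComparisonRegPrIntLS2BetaOneStepMeanLetter (holAt_walk_replicate_false axialAvg_eq_rowProd)
open Summit.QuantumFields.YangMills.Theorems.FluctuationComparisonRegPrIntLS2BetaRelativeStokes
  (dist1_rel_mul_le dist1_rel_conj_le dist1_rel_inv dist1_mul_inv_eq_rel dist1_rel_comm)
open Summit.QuantumFields.YangMills.Theorems.FluctuationComparisonRegPrIntLS2BetaRelativeMemberLetters (dist1_rel_prod3_le)

variable {P : Params} {j : ℕ} {G : Type*} [GaugeGroup G]

/-! ## §1 Group algebra: an inverse-conjugated triple product, relative and absolute -/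

/-- ★ **RELATIVE INVERSE CONJUGATION**: `δ(H⁻¹·Z·H, H₀⁻¹·Z₀·H₀) ≤ δ(Z, Z₀) + 2·dist1 Z·dist1 (H⁻¹·H₀)` (✓`dist1_rel_conj_le` with `T := H⁻¹`; the commutator letter
`hcomm` on the group). [folklore] -/
theorem dist1_invConj_rel_le (hcomm : ∀ g h : G, dist1 (g * h * g⁻¹ * h⁻¹) ≤ 2 * dist1 g * dist1 h) (Z Z₀ H H₀ : G) :
    dist1 ((H₀⁻¹ * Z₀ * H₀)⁻¹ * (H⁻¹ * Z * H)) ≤ dist1 (Z₀⁻¹ * Z) + 2 * dist1 Z * dist1 (H⁻¹ * H₀) := by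
  have h := dist1_rel_conj_le hcomm Z Z₀ H⁻¹ H₀⁻¹
  rw [inv_inv, inv_inv, dist1_mul_inv_eq_rel] at h
  exact h

/-- `δ(A·B⁻¹, A₀·B₀⁻¹) ≤ δ(A, A₀) + δ(B, B₀)`. [folklore] -/
theorem dist1_mulInv_rel_le (A B A₀ B₀ : G) :
    dist1 ((A₀ * B₀⁻¹)⁻¹ * (A * B⁻¹)) ≤ dist1 (A₀⁻¹ * A) + dist1 (B₀⁻¹ * B) := by
  refine (dist1_rel_mul_le _ _ _ _).trans (add_le_add le_rfl ?_)
  rw [dist1_rel_inv]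

/-- `dist1 (A·S·B⁻¹) ≤ dist1 A + dist1 S + dist1 B`. [folklore] -/
theorem dist1_prod3_le (A S B : G) : dist1 (A * S * B⁻¹) ≤ dist1 A + dist1 S + dist1 B := by
  refine (GaugeGroup.dist1_mul_le _ _).trans (add_le_add (GaugeGroup.dist1_mul_le _ _) ?_)
  rw [GaugeGroup.dist1_inv]

/-- The numeric step `δ + 2·z·h ≤ δ + 2·Θ·t` from `dist1 Z ≤ Θ`, `dist1 (…) ≤ t`. [folklore] -/
private theorem junk_le {z h Θ t : ℝ} (hz0 : 0 ≤ z) (hh0 : 0 ≤ h) (hz : z ≤ Θ) (hh : h ≤ t) : 2 * z * h ≤ 2 * Θ * t :=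
  mul_le_mul (mul_le_mul_of_nonneg_left hz zero_le_two) hh hh0 (by linarith)

/-! ## §2 INTERIOR bonds -/

/-- ★★ **THE TWO-TOWER INTERIOR LETTER, POINTWISE** (height `j`, standing range; `b = ⟨x, μ⟩` with both endpoints in the block of `y`; the pairs `(W, U)` and
`(W⁰, U⁰)` comb-axial from every block centre, ✓(T4) of the stage towers):
`δ(W_b·U_b⁻¹, W⁰_b·U⁰_b⁻¹) ≤ a + b + 2·(θ₁ + θ₂)·t`, where (all read from `emb y` along `contourT (emb y) b = Γ_{y,x} ∪ b ∪ Γ_{y,x+e_μ}⁻¹`, a CLOSED word)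
`a ≥ dist1 (𝒲⁰(contour)⁻¹·𝒲(contour))`, `b ≥ dist1 (𝒰⁰(contour)⁻¹·𝒰(contour))`, `θ₁ ≥ dist1 𝒲(contour)`, `θ₂ ≥ dist1 𝒰(contour)`, and
`t ≥ dist1 ((axialT U (emb y) x)⁻¹·axialT U⁰ (emb y) x)` (the relative comb transport of the two BACKGROUNDS).  Algebra: ✓`mul_inv_eq_conj_of_axial` for both
pairs, §1. [cite: Balaban1985RegularSpaces, Lemma 1 (1.25) p.79; Balaban1985Averaging, (19)-(20) p.21] -/
theorem dist1_flap_rel_le_interior (hcomm : ∀ g h : G, dist1 (g * h * g⁻¹ * h⁻¹) ≤ 2 * dist1 g * dist1 h) (hj : j + 1 ≤ P.m + P.K)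
    (W U W₀ U₀ : GaugeField P j G)
    (hax : ∀ z : Site P j, axialT W (emb (blockOf z)) z = axialT U (emb (blockOf z)) z)
    (hax₀ : ∀ z : Site P j, axialT W₀ (emb (blockOf z)) z = axialT U₀ (emb (blockOf z)) z)
    {x : Site P j} {y : Site P (j + 1)} (hx : blockOf x = y) (μ : Fin P.d) (hblock : blockOf (x.shift μ) = y)
    {a b θ₁ θ₂ t : ℝ}
    (ha : dist1 ((holT W₀ (emb y) (contourT (emb y) ⟨x, μ⟩))⁻¹ * holT W (emb y) (contourT (emb y) ⟨x, μ⟩)) ≤ a)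
    (hb : dist1 ((holT U₀ (emb y) (contourT (emb y) ⟨x, μ⟩))⁻¹ * holT U (emb y) (contourT (emb y) ⟨x, μ⟩)) ≤ b)
    (hθ₁ : dist1 (holT W (emb y) (contourT (emb y) ⟨x, μ⟩)) ≤ θ₁) (hθ₂ : dist1 (holT U (emb y) (contourT (emb y) ⟨x, μ⟩)) ≤ θ₂)
    (ht : dist1 ((axialT U (emb y) x)⁻¹ * axialT U₀ (emb y) x) ≤ t) :
    dist1 ((W₀ ⟨x, μ⟩ * (U₀ ⟨x, μ⟩)⁻¹)⁻¹ * (W ⟨x, μ⟩ * (U ⟨x, μ⟩)⁻¹)) ≤ a + b + 2 * (θ₁ + θ₂) * t := by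
  have hwrap := noWrap_emb hj hx μ
  have h1 : axialT W (emb y) x = axialT U (emb y) x := by have h := hax x; rwa [hx] at h
  have h1' : axialT W (emb y) (x.shift μ) = axialT U (emb y) (x.shift μ) := by have h := hax (x.shift μ); rwa [hblock] at h
  have h0 : axialT W₀ (emb y) x = axialT U₀ (emb y) x := by have h := hax₀ x; rwa [hx] at h
  have h0' : axialT W₀ (emb y) (x.shift μ) = axialT U₀ (emb y) (x.shift μ) := by have h := hax₀ (x.shift μ); rwa [hblock] at h
  rw [mul_inv_eq_conj_of_axial W U (emb y) x μ hwrap h1 h1', mul_inv_eq_conj_of_axial W₀ U₀ (emb y) x μ hwrap h0 h0']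
  set CW := holT W (emb y) (contourT (emb y) ⟨x, μ⟩)
  set CU := holT U (emb y) (contourT (emb y) ⟨x, μ⟩)
  set CW₀ := holT W₀ (emb y) (contourT (emb y) ⟨x, μ⟩)
  set CU₀ := holT U₀ (emb y) (contourT (emb y) ⟨x, μ⟩)
  refine (dist1_invConj_rel_le hcomm _ _ _ _).trans ?_
  have hZ : dist1 ((CW₀ * CU₀⁻¹)⁻¹ * (CW * CU⁻¹)) ≤ a + b := (dist1_mulInv_rel_le _ _ _ _).trans (add_le_add ha hb)
  have hZθ : dist1 (CW * CU⁻¹) ≤ θ₁ + θ₂ := by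
    refine (GaugeGroup.dist1_mul_le _ _).trans (add_le_add hθ₁ ?_)
    rw [GaugeGroup.dist1_inv]; exact hθ₂
  have hj' := junk_le (GaugeGroup.dist1_nonneg _) (GaugeGroup.dist1_nonneg _) hZθ ht
  linarith

/-! ## §3 FACE bonds -/

/-- The open face word from `emb y` ends at the next centre `emb (y + e_μ)`. [folklore] -/
theorem walkEnd_faceWord (y : Site P (j + 1)) (x : Site P j) (μ : Fin P.d) :
    walkEnd (emb y) (treeWord (rel (emb y) x) ++ [(μ, true)] ++ wordRev (treeWord (rel (emb (y.shift μ)) (x.shift μ)))) = emb (y.shift μ) := by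
  have key : ∀ w : List (Letter P.d), walkEnd (emb (y.shift μ)) w = x.shift μ → walkEnd (x.shift μ) (wordRev w) = emb (y.shift μ) :=
    fun w hw => by rw [← hw, walkEnd_walkEnd_wordRev]
  rw [walkEnd_append, walkEnd_append, walkEnd_treeWord_rel]
  exact key _ (walkEnd_treeWord_rel _ _)

/-- ★ **THE CLOSED FACE LOOP** `Γ_{y,x} ∪ [x, x+e_μ] ∪ (−Γ_{y+e_μ, x+e_μ}) ∪ (−spine)` read from `emb y`: for a pair `(W, U)` with the same comb transports from `emb y` to
`x` and from `emb (y+e_μ)` to `x + e_μ`, its `W`-holonomy is `H·W_b·H′⁻¹·T_c(W)⁻¹` with `H = axialT U (emb y) x`, `H′ = axialT U (emb (y+e_μ)) (x+e_μ)` and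
`T_c(W) = axialAvg W ⟨y, μ⟩` the straight spine transport (✓`holAt_faceWord_of_axial` + ✓`holAt_walk_replicate_false`). [cite: Balaban1985Averaging, (9)-(10) p.19] -/
theorem holAt_faceLoop_eq (W U : GaugeField P j G) (y : Site P (j + 1)) (x : Site P j) (μ : Fin P.d)
    (hax : axialT W (emb y) x = axialT U (emb y) x) (hax' : axialT W (emb (y.shift μ)) (x.shift μ) = axialT U (emb (y.shift μ)) (x.shift μ)) :
    holAt W (walk (emb y) ((treeWord (rel (emb y) x) ++ [(μ, true)] ++ wordRev (treeWord (rel (emb (y.shift μ)) (x.shift μ)))) ++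
        List.replicate P.L (μ, false))) =
      axialT U (emb y) x * W ⟨x, μ⟩ * (axialT U (emb (y.shift μ)) (x.shift μ))⁻¹ * (AveragingRT.axialAvg W ⟨y, μ⟩)⁻¹ := by
  rw [walk_append, holAt_append, walkEnd_faceWord, holAt_faceWord_of_axial W U (emb y) (emb (y.shift μ)) x μ hax hax', emb_shift_eq_shiftN,
    holAt_walk_replicate_false, axialAvg_eq_rowProd]

/-- ★ **THE FACE FLAP AS AN INVERSE CONJUGATE**: with `C_W`, `C_U` the closed face loops of `W`, `U` (as in ✓`holAt_faceLoop_eq`) and `T_c` the straight spine transports,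
`W_b·U_b⁻¹ = H⁻¹·(C_W·(T_c(W)·T_c(U)⁻¹)·C_U⁻¹)·H`, `H = axialT U (emb y) x` (the `hkey` of ✓`dist1_mul_inv_le_three`, as an identity). [cite: Balaban1985Averaging, (9)-(10) p.19] -/
theorem flap_eq_invConj_face (W U : GaugeField P j G) (y : Site P (j + 1)) (x : Site P j) (μ : Fin P.d)
    (hax : axialT W (emb y) x = axialT U (emb y) x) (hax' : axialT W (emb (y.shift μ)) (x.shift μ) = axialT U (emb (y.shift μ)) (x.shift μ)) :
    W ⟨x, μ⟩ * (U ⟨x, μ⟩)⁻¹ =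
      (axialT U (emb y) x)⁻¹ *
        (holAt W (walk (emb y) ((treeWord (rel (emb y) x) ++ [(μ, true)] ++ wordRev (treeWord (rel (emb (y.shift μ)) (x.shift μ)))) ++
            List.replicate P.L (μ, false))) *
          (AveragingRT.axialAvg W ⟨y, μ⟩ * (AveragingRT.axialAvg U ⟨y, μ⟩)⁻¹) *
          (holAt U (walk (emb y) ((treeWord (rel (emb y) x) ++ [(μ, true)] ++ wordRev (treeWord (rel (emb (y.shift μ)) (x.shift μ)))) ++
            List.replicate P.L (μ, false))))⁻¹) *
        axialT U (emb y) x := by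
  rw [holAt_faceLoop_eq W U y x μ hax hax', holAt_faceLoop_eq U U y x μ rfl rfl]
  group

/-- ★★ **THE TWO-TOWER FACE LETTER, POINTWISE** (height `j`, standing range; `b = ⟨x, μ⟩` with `x` on the `μ`-face of the block of `y`; both pairs comb-axial from every
block centre): `δ(W_b·U_b⁻¹, W⁰_b·U⁰_b⁻¹) ≤ a + s + b + 2·(θ₁ + σ + θ₂)·t`, where, with `C_X` the closed face loop of `X` read from `emb y` (✓`holAt_faceLoop_eq`) and
`S = T_c(W)·T_c(U)⁻¹`, `S⁰ = T_c(W⁰)·T_c(U⁰)⁻¹` the SPINE QUOTIENTS at the coarse bond `c = ⟨y, μ⟩`: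
`a ≥ dist1 (C_{W⁰}⁻¹·C_W)`, `b ≥ dist1 (C_{U⁰}⁻¹·C_U)`, `s ≥ dist1 (S⁰⁻¹·S)`, `θ₁ ≥ dist1 C_W`, `θ₂ ≥ dist1 C_U`, `σ ≥ dist1 S`,
`t ≥ dist1 ((axialT U (emb y) x)⁻¹·axialT U⁰ (emb y) x)`.  The coarse transporters enter ONLY through the relative spine quotient `s` (= F4-rel's letter once the
backgrounds reproduce the (0.4) averages) and its size `σ`. [cite: Balaban1985RegularSpaces, Lemma 1 (1.26) p.79; Balaban1985Averaging, (19)-(20) p.21; Balaban1987RG1, (0.4) p.253] -/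
theorem dist1_flap_rel_le_face (hcomm : ∀ g h : G, dist1 (g * h * g⁻¹ * h⁻¹) ≤ 2 * dist1 g * dist1 h) (hj : j + 1 ≤ P.m + P.K)
    (W U W₀ U₀ : GaugeField P j G)
    (hax : ∀ z : Site P j, axialT W (emb (blockOf z)) z = axialT U (emb (blockOf z)) z)
    (hax₀ : ∀ z : Site P j, axialT W₀ (emb (blockOf z)) z = axialT U₀ (emb (blockOf z)) z)
    {x : Site P j} {y : Site P (j + 1)} (hx : blockOf x = y) {μ : Fin P.d} (hface : (x μ).val % P.L + 1 = P.L)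
    {a b s θ₁ θ₂ σ t : ℝ}
    (ha : dist1 ((holAt W₀ (walk (emb y) ((treeWord (rel (emb y) x) ++ [(μ, true)] ++ wordRev (treeWord (rel (emb (y.shift μ)) (x.shift μ)))) ++
        List.replicate P.L (μ, false))))⁻¹ *
      holAt W (walk (emb y) ((treeWord (rel (emb y) x) ++ [(μ, true)] ++ wordRev (treeWord (rel (emb (y.shift μ)) (x.shift μ)))) ++
        List.replicate P.L (μ, false)))) ≤ a)
    (hb : dist1 ((holAt U₀ (walk (emb y) ((treeWord (rel (emb y) x) ++ [(μ, true)] ++ wordRev (treeWord (rel (emb (y.shift μ)) (x.shift μ)))) ++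
        List.replicate P.L (μ, false))))⁻¹ *
      holAt U (walk (emb y) ((treeWord (rel (emb y) x) ++ [(μ, true)] ++ wordRev (treeWord (rel (emb (y.shift μ)) (x.shift μ)))) ++
        List.replicate P.L (μ, false)))) ≤ b)
    (hs : dist1 ((AveragingRT.axialAvg W₀ ⟨y, μ⟩ * (AveragingRT.axialAvg U₀ ⟨y, μ⟩)⁻¹)⁻¹ *
      (AveragingRT.axialAvg W ⟨y, μ⟩ * (AveragingRT.axialAvg U ⟨y, μ⟩)⁻¹)) ≤ s)
    (hθ₁ : dist1 (holAt W (walk (emb y) ((treeWord (rel (emb y) x) ++ [(μ, true)] ++ wordRev (treeWord (rel (emb (y.shift μ)) (x.shift μ)))) ++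
        List.replicate P.L (μ, false)))) ≤ θ₁)
    (hθ₂ : dist1 (holAt U (walk (emb y) ((treeWord (rel (emb y) x) ++ [(μ, true)] ++ wordRev (treeWord (rel (emb (y.shift μ)) (x.shift μ)))) ++
        List.replicate P.L (μ, false)))) ≤ θ₂)
    (hσ : dist1 (AveragingRT.axialAvg W ⟨y, μ⟩ * (AveragingRT.axialAvg U ⟨y, μ⟩)⁻¹) ≤ σ)
    (ht : dist1 ((axialT U (emb y) x)⁻¹ * axialT U₀ (emb y) x) ≤ t) :
    dist1 ((W₀ ⟨x, μ⟩ * (U₀ ⟨x, μ⟩)⁻¹)⁻¹ * (W ⟨x, μ⟩ * (U ⟨x, μ⟩)⁻¹)) ≤ a + s + b + 2 * (θ₁ + σ + θ₂) * t := by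
  have hblock : blockOf (x.shift μ) = y.shift μ := by rw [B10StarCount.blockOf_shift hj, if_pos hface, hx]
  have h1 : axialT W (emb y) x = axialT U (emb y) x := by have h := hax x; rwa [hx] at h
  have h1' : axialT W (emb (y.shift μ)) (x.shift μ) = axialT U (emb (y.shift μ)) (x.shift μ) := by
    have h := hax (x.shift μ); rwa [hblock] at h
  have h0 : axialT W₀ (emb y) x = axialT U₀ (emb y) x := by have h := hax₀ x; rwa [hx] at h
  have h0' : axialT W₀ (emb (y.shift μ)) (x.shift μ) = axialT U₀ (emb (y.shift μ)) (x.shift μ) := by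
    have h := hax₀ (x.shift μ); rwa [hblock] at h
  rw [flap_eq_invConj_face W U y x μ h1 h1', flap_eq_invConj_face W₀ U₀ y x μ h0 h0']
  set CW := holAt W (walk (emb y) ((treeWord (rel (emb y) x) ++ [(μ, true)] ++ wordRev (treeWord (rel (emb (y.shift μ)) (x.shift μ)))) ++
        List.replicate P.L (μ, false)))
  set CU := holAt U (walk (emb y) ((treeWord (rel (emb y) x) ++ [(μ, true)] ++ wordRev (treeWord (rel (emb (y.shift μ)) (x.shift μ)))) ++
        List.replicate P.L (μ, false)))
  set CW₀ := holAt W₀ (walk (emb y) ((treeWord (rel (emb y) x) ++ [(μ, true)] ++ wordRev (treeWord (rel (emb (y.shift μ)) (x.shift μ)))) ++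
        List.replicate P.L (μ, false)))
  set CU₀ := holAt U₀ (walk (emb y) ((treeWord (rel (emb y) x) ++ [(μ, true)] ++ wordRev (treeWord (rel (emb (y.shift μ)) (x.shift μ)))) ++
        List.replicate P.L (μ, false)))
  set S := AveragingRT.axialAvg W ⟨y, μ⟩ * (AveragingRT.axialAvg U ⟨y, μ⟩)⁻¹
  set S₀ := AveragingRT.axialAvg W₀ ⟨y, μ⟩ * (AveragingRT.axialAvg U₀ ⟨y, μ⟩)⁻¹
  refine (dist1_invConj_rel_le hcomm _ _ _ _).trans ?_
  have hZ : dist1 ((CW₀ * S₀ * CU₀⁻¹)⁻¹ * (CW * S * CU⁻¹)) ≤ a + s + b :=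
    (dist1_rel_prod3_le _ _ _ _ _ _).trans (add_le_add (add_le_add ha hs) hb)
  have hZθ : dist1 (CW * S * CU⁻¹) ≤ θ₁ + σ + θ₂ := (dist1_prod3_le _ _ _).trans (add_le_add (add_le_add hθ₁ hσ) hθ₂)
  have hj' := junk_le (GaugeGroup.dist1_nonneg _) (GaugeGroup.dist1_nonneg _) hZθ ht
  linarith

/-- The relative spine quotient in the two readings: `dist1 ((T_c(W⁰)·T_c(U⁰)⁻¹)⁻¹·(T_c(W)·T_c(U)⁻¹))` is F4-rel's `dist1 (κ_c(W⁰)⁻¹·κ_c(W))` once BOTH backgrounds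
reproduce the (0.4) averages along the spine (`T_c(U) = ū_c(W)`, `T_c(U⁰) = ū_c(W⁰)`; ✓(b3) `axialAvg_mul_avgFun_inv`). [cite: Balaban1987RG1, (0.4) p.253] -/
theorem dist1_spine_rel_eq_corr_rel (ℰ : LoopAverage G) (W U W₀ U₀ : GaugeField P j G) (c : PBond P (j + 1))
    (havg : AveragingRT.axialAvg U c = avgFun ℰ W c) (havg₀ : AveragingRT.axialAvg U₀ c = avgFun ℰ W₀ c) :
    dist1 ((AveragingRT.axialAvg W₀ c * (AveragingRT.axialAvg U₀ c)⁻¹)⁻¹ * (AveragingRT.axialAvg W c * (AveragingRT.axialAvg U c)⁻¹)) =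
      dist1 ((corr ℰ W₀ c)⁻¹ * corr ℰ W c) := by
  rw [havg, havg₀, FluctuationComparisonRegPrIntLS2BetaOneStepMeanLetter.axialAvg_mul_avgFun_inv,
    FluctuationComparisonRegPrIntLS2BetaOneStepMeanLetter.axialAvg_mul_avgFun_inv, inv_inv, dist1_mul_inv_eq_rel, dist1_rel_comm]

end Summit.QuantumFields.YangMills.Theorems.FluctuationComparisonRegPrIntLS2BetaRelativeFieldLetterTwoTower
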